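import Summits.CriticalPhenomena.PercolationContinuityZ3.Theorems.Transplant.HexShadowLemma4
import HarnessLib

/-!
# HEXAGONAL SHADOWS XV — the node of record: DST's GLUING LEMMA 6 in hexagonal geometry (`HexShadow.HexGluing`), Lemma 5, and
# eqs. (10)–(12): **eq. (12) for `p < 1` from the Gluing Lemma alone**

builds on p205010 (kernel theorem, internal audit signed; external expert review pending) — NOT used in this file.
Lane `prim-bschramm`, seat `prim-bschramm-p2` (gen 32; class C1b; memo `HOME/bschramm/P2-LATTICES.md` §115–§116); helper file
(`--supports stmt-CriticalPhenomena-4575 --as helper`).  Slab originals: `DuminilCopinSidoraviciusTassion2016_lemma6'` (`SlabCriticalityChain4`),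
`DuminilCopinSidoraviciusTassion2016_lemma5`, `DuminilCopinSidoraviciusTassion2016_eq12_of_lemmas` (`SlabCriticality`).

THE GEOMETRY (scale `m`, even radii; `c` = centre, `P` = period).  `H₃ = hexBall c 6m` (DST's `B_{3n}`), `S₃ = hexBall c u₃` (`2u₃ ≤ 3m`, i.e. `u₃ ≤ (6m)/4`:
NO touching), the auxiliary hexagon `B' = hexBall c' 2m`, `c' = glueCentre m s = c + (4m, P·s)` — a point of the symmetry lattice `c + P•ℤ²` when `P ∣ m` —
whose side `{(w−c)₀ = 6m}` lies on the side line of `H₃`; `S' = hexBall c' u₁` (`2u₁ ≤ m`); on that side, in `B'`-midpoint coordinates `x' ∈ [−m, m]`: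
the landing zone `Z = hexSide c' m (−a) a` and `Y⁻ = hexSide c' m (−m) (−a)`, `Y⁺ = hexSide c' m a m` (`1 ≤ a ≤ m − 1`).  Events `A = S₃ ⟷^{H₃} Z`,
`B∓ = S' ⟷^{B'} Y∓`, `C = S₃ ⟷^{H₃ ∪ B'} S'`.
* §1 the vocabulary and **the node `HexShadow.HexGluing`**: for `θ_v(p) > 0`, `p < 1`: `∀ ε > 0 ∃ δ > 0 ∃ m₀ ∀ m ≥ m₀ (P ∣ m) ∀` data in range,
  `P_p[A ∩ B⁻ ∩ B⁺] ≥ 1 − δ ⇒ P_p[C] ≥ 1 − ε` — DST's Lemma 6 verbatim in hexagonal geometry, in the non-touching range and for large scales only.  An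
  internal obligation, never asserted: it is what §2.3 of the paper (multi-valued map principle, `γ_min`, `U(ω)`, Facts 1–2 with a local-surgery
  hypothesis on the instance) proves; the ONLY remaining node of the `(111)`-film / `𝕋×{0..k}` rows («HexShadowEq12»).
* §2 Lemma 5 with a linear bound (`lemma5_linear`: `1 ≤ α_n ≤ K n ⇒ α_{3n} ≤ 4α_n` infinitely often), used along the multiples of the period.
* §3 **`eq12_of_hexGluing_lt_one`**: for `p < 1`, `θ_v(p) > 0`, `u` with `4u_n ≤ n` and eq. (1), the Gluing Lemma gives DST's eq. (12) in the form of
  `Eq12Likely4`: Lemma 4 («HexShadowLemma4») at scales `m` and `3m` (`m ∈ P•ℕ` by Lemma 5), the landing interval `[a_{3m}, b_{3m}]` of length `≤ 2α_m`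
  inside `Z` of half-width `a = α_m + P` centred at the lattice point `c'` nearest below the midpoint (the SLACK of «HexShadowLemma4» pays for the
  rounding), `P[B±] = P[E_m(α_m + P, m)]` by translation and the side flip, Harris twice (eq. (11)), the node, `H₃ ∪ B' ⊆ hexBall c 8m`.
[cite: DuminilCopinSidoraviciusTassion2016, §2.1 Lemma 5, Lemma 6, eqs. (10)–(12)] [cite: GrimmettPercolation1999, Thm. 2.4 and §1.6 p. 16]
-/

noncomputable section

namespace Summit.CriticalPhenomena.PercolationContinuityZ3.Theorems.Transplant

open MeasureTheory Literature.Probability.Percolation Literature.Probability.LatticeModels SimpleGraph Filter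
open scoped Classical Topology

namespace HexShadow

variable {V : Type} {G : SimpleGraph V} (Φ : HexShadow G)

/-! ## §1 The three-hexagon configuration and the node -/

/-- The centre `c' = c + (4m, period·s)` of the auxiliary hexagon `B' = hexBall c' 2m` at scale `m` with side offset `s` (a point of the symmetry lattice
`c + period•ℤ²` when `period ∣ m`). [cite: DuminilCopinSidoraviciusTassion2016, §2.1 (B'_n = (2n, y) + B_n)] -/
def glueCentre (m : ℕ) (s : ℤ) : Site 2 := Φ.centre + ![4 * (m : ℤ), (Φ.period : ℤ) * s]

/-- **`A = S₃ ⟷^{H₃} Z`**: the inner hexagon `hexBall c u₃` is joined inside `hexBall c 6m` to the landing zone `Z = hexSide c' m (−a) a` (the middle of the side of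
`B'` on the side line `{(w − c)₀ = 6m}` of `hexBall c 6m`). [cite: DuminilCopinSidoraviciusTassion2016, §2.1 (S_{3n} ⟷^{B_{3n}} Z_n)] -/
def glueA (m u₃ a : ℕ) (s : ℤ) : Set (BondConfig V) :=
  Φ.conn (hexBall Φ.centre (6 * m)) (hexBall Φ.centre u₃) (hexSide (Φ.glueCentre m s) m (-(a : ℤ)) a)

/-- **`B⁻ = S' ⟷^{B'} Y⁻`**, `Y⁻ = hexSide c' m (−m) (−a)`. [cite: DuminilCopinSidoraviciusTassion2016, §2.1 (S'_n ⟷^{B'_n} Y_n^-)] -/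
def glueBm (m u₁ a : ℕ) (s : ℤ) : Set (BondConfig V) := Φ.sideEvent (Φ.glueCentre m s) m u₁ (-(m : ℤ)) (-(a : ℤ))

/-- **`B⁺ = S' ⟷^{B'} Y⁺`**, `Y⁺ = hexSide c' m a m`. [cite: DuminilCopinSidoraviciusTassion2016, §2.1 (S'_n ⟷^{B'_n} Y_n^+)] -/
def glueBp (m u₁ a : ℕ) (s : ℤ) : Set (BondConfig V) := Φ.sideEvent (Φ.glueCentre m s) m u₁ a m

/-- **`C = S₃ ⟷^{H₃ ∪ B'} S'`**: the glued connection. [cite: DuminilCopinSidoraviciusTassion2016, Lemma 6 (S_{3n} ⟷^{B_{3n} ∪ B'_n} S'_n)] -/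
def glueC (m u₃ u₁ : ℕ) (s : ℤ) : Set (BondConfig V) :=
  Φ.conn (hexBall Φ.centre (6 * m) ∪ hexBall (Φ.glueCentre m s) (2 * m)) (hexBall Φ.centre u₃) (hexBall (Φ.glueCentre m s) u₁)

/-- **THE NODE — DST's GLUING LEMMA 6 in hexagonal geometry.**  For `θ_v(p) > 0` and `p < 1`: for every `ε > 0` there are `δ > 0` and a scale `m₀` such
that for all scales `m ≥ m₀` divisible by the period and all data in range — inner radii `u₃ ≤ 3m/2` (NO touching of `S₃` and `B'`), `u₁ ≤ m/2`, landing
half-width `1 ≤ a ≤ m − 1`, side offset `period·s ∈ [−3m, m]` —, `P_p[A ∩ B⁻ ∩ B⁺] ≥ 1 − δ` implies `P_p[C] ≥ 1 − ε`.  ("Projections of paths from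
`S̄₃` to `Z̄` and from `S̄'` to `Ȳ⁻`, `Ȳ⁺` must intersect, but the paths themselves have no reason to do so"; proved in §2.3 of the paper from the
multi-valued map principle — `γ_min`, `U(ω)`, Fact 1 (closing the columns of `U`), Fact 2 (a local surgery, for which the instance must supply three
disjoint paths in a column block).)  An internal obligation, never asserted. [cite: DuminilCopinSidoraviciusTassion2016, Lemma 6 and §2.3] -/
def HexGluing {V : Type} {G : SimpleGraph V} (Φ : HexShadow G) [Countable V] : Prop :=
  ∀ (v : V) (p : unitInterval), 0 < theta G v p → (p : ℝ) < 1 → ∀ ε : ℝ, 0 < ε → ∃ δ : ℝ, 0 < δ ∧ ∃ m₀ : ℕ,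
    ∀ (m u₃ u₁ a : ℕ) (s : ℤ), m₀ ≤ m → Φ.period ∣ m → 2 * u₃ ≤ 3 * m → 2 * u₁ ≤ m → 1 ≤ a → a + 1 ≤ m →
      -(3 * (m : ℤ)) ≤ Φ.period * s → (Φ.period : ℤ) * s ≤ m →
      1 - δ ≤ (bondPercolation G p).real (Φ.glueA m u₃ a s ∩ Φ.glueBm m u₁ a s ∩ Φ.glueBp m u₁ a s) →
      1 - ε ≤ (bondPercolation G p).real (Φ.glueC m u₃ u₁ s)

/-! ## §2 Lemma 5 with a linear bound -/

/-- **DST 2016, Lemma 5, for a linearly bounded sequence**: if `1 ≤ α_n ≤ K·n` (`n ≥ 1`) then `α_{3n} ≤ 4α_n` for infinitely many `n` (a sequence with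
`α_{3n} > 4α_n` eventually grows like `4^j` along `3^j N`, faster than `K·3^j N`). [cite: DuminilCopinSidoraviciusTassion2016, Lemma 5] -/
theorem lemma5_linear (K : ℕ) (α : ℕ → ℕ) (hpos : ∀ n, 1 ≤ n → 1 ≤ α n) (hle : ∀ n, 1 ≤ n → α n ≤ K * n) :
    ∀ N : ℕ, ∃ n, N ≤ n ∧ 1 ≤ n ∧ α (3 * n) ≤ 4 * α n := by
  intro N
  by_contra hcon
  push Not at hcon
  set N' := max N 1 with hN'
  have hN'1 : 1 ≤ N' := le_max_right _ _
  have hgrow : ∀ n, N' ≤ n → 4 * α n < α (3 * n) := fun n hn => hcon n ((le_max_left _ _).trans hn) (hN'1.trans hn)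
  have hj : ∀ j : ℕ, (4 : ℝ) ^ j ≤ K * (3 ^ j * N') := by
    intro j
    have h1 := DuminilCopinSidoraviciusTassion2016_lemma5_growth α N' (hpos N' hN'1) hgrow j
    have h2 := hle (3 ^ j * N') (Nat.le_mul_of_pos_left N' (pow_pos (by norm_num) j) |>.trans' hN'1)
    exact_mod_cast h1.trans h2
  have hlim : Tendsto (fun j : ℕ => ((4 : ℝ) / 3) ^ j) atTop atTop := tendsto_pow_atTop_atTop_of_one_lt (by norm_num)
  obtain ⟨j, hj'⟩ := (hlim.eventually_gt_atTop ((K : ℝ) * N')).exists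
  have h3pos : (0 : ℝ) < 3 ^ j := pow_pos (by norm_num) j
  have : ((4 : ℝ) / 3) ^ j ≤ K * N' := by
    rw [div_pow, div_le_iff₀ h3pos]
    have := hj j
    nlinarith
  linarith

/-! ## §3 Eq. (12) for `p < 1` from the Gluing Lemma -/

/-- The side offset geometry: `glueCentre m s = c + period • (4j, s)` when `m = period·j`. [folklore] -/
theorem glueCentre_eq_shift {m j : ℕ} (hm : m = Φ.period * j) (s : ℤ) :
    Φ.glueCentre m s = Φ.centre + (Φ.period : ℤ) • (![4 * (j : ℤ), s] : Site 2) := by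
  unfold glueCentre
  congr 1
  ext i; fin_cases i
  · simp [hm]; ring
  · simp

/-- `glueCentre m s` in the coordinates of `Eq12Likely4` (`n = 2m`): `c + (2n)•e₀ + (period·s)•e₁`. [folklore] -/
theorem glueCentre_eq_single (m : ℕ) (s : ℤ) :
    Φ.glueCentre m s = Φ.centre + (2 * ((2 * m : ℕ) : ℤ)) • (Pi.single 0 1 : Site 2) + ((Φ.period : ℤ) * s) • (Pi.single 1 1 : Site 2) := by
  unfold glueCentre
  rw [add_assoc]
  congr 1
  ext i; fin_cases i
  · simp; ring
  · simp

/-- The triangle inequality for `triNorm`, distance form (private copy). [folklore] -/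
private theorem triNorm_sub_le₁₅ (u v w : Site 2) : triNorm (u - w) ≤ triNorm (u - v) + triNorm (v - w) := by
  simp only [triNorm, Pi.sub_apply, max_le_iff]
  have l0 := (abs_le_triNorm (u - v)).1; have l1 := (abs_le_triNorm (u - v)).2
  have l2 : |(u - v) 0 + (u - v) 1| ≤ triNorm (u - v) := (le_max_right _ _).trans (le_max_right _ _)
  have m0 := (abs_le_triNorm (v - w)).1; have m1 := (abs_le_triNorm (v - w)).2
  have m2 : |(v - w) 0 + (v - w) 1| ≤ triNorm (v - w) := (le_max_right _ _).trans (le_max_right _ _)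
  simp only [triNorm, Pi.sub_apply] at l0 l1 l2 m0 m1 m2 ⊢
  rw [abs_le] at l0 l1 l2 m0 m1 m2
  refine ⟨abs_le.2 ⟨?_, ?_⟩, abs_le.2 ⟨?_, ?_⟩, abs_le.2 ⟨?_, ?_⟩⟩ <;> linarith

/-- **`H₃ ∪ B' ⊆ hexBall c 8m`** for side offsets `period·s ∈ [−3m, m]` (`triNorm (c' − c) ≤ 5m`). [folklore] -/
theorem glueRegion_subset (m : ℕ) {s : ℤ} (hs1 : -(3 * (m : ℤ)) ≤ Φ.period * s) (hs2 : (Φ.period : ℤ) * s ≤ m) :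
    hexBall Φ.centre (6 * m) ∪ hexBall (Φ.glueCentre m s) (2 * m) ⊆ hexBall Φ.centre (4 * (2 * m)) := by
  rintro w (hw | hw)
  · exact hexBall_mono _ (by omega) hw
  · rw [mem_hexBall] at hw ⊢
    have hd : triNorm (Φ.glueCentre m s - Φ.centre) ≤ 5 * m := by
      unfold glueCentre
      rw [add_sub_cancel_left]
      simp only [triNorm, Matrix.cons_val_zero, Matrix.cons_val_one, max_le_iff, abs_le]
      refine ⟨⟨?_, ?_⟩, ⟨?_, ?_⟩, ⟨?_, ?_⟩⟩ <;> linarith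
    have t := triNorm_sub_le₁₅ w (Φ.glueCentre m s) Φ.centre
    push_cast at hw ⊢; linarith

/-- **The landing interval sits inside the landing zone** (eq. (10)): with `[a₃, b₃]` of length `≤ 2α` (Lemma 4 at scale `3m`, Lemma 5), `y = ⌊(a₃+b₃)/2⌋`,
`period·s ≤ y − 2m < period·s + period` and half-width `a = α + period`: `hexSide c (3m) a₃ b₃ ⊆ hexSide c' m (−a) a`.
[cite: DuminilCopinSidoraviciusTassion2016, §2.1 eq. (10)] -/
theorem hexSide_subset_landingZone {m α a₃ b₃ : ℕ} {s : ℤ} (hab : a₃ ≤ b₃) (hlen : b₃ - a₃ ≤ 2 * α)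
    (hs1 : (Φ.period : ℤ) * s ≤ ((a₃ + b₃) / 2 : ℕ) - 2 * (m : ℤ)) (hs2 : (((a₃ + b₃) / 2 : ℕ) : ℤ) - 2 * (m : ℤ) < Φ.period * s + Φ.period) :
    hexSide Φ.centre (3 * m) a₃ b₃ ⊆ hexSide (Φ.glueCentre m s) m (-((α + Φ.period : ℕ) : ℤ)) ((α + Φ.period : ℕ) : ℤ) := by
  rintro w ⟨h0, h1, h2⟩
  have hy1 : 2 * ((a₃ + b₃) / 2) ≤ a₃ + b₃ := Nat.mul_div_le _ _
  have hy2 : a₃ + b₃ < 2 * ((a₃ + b₃) / 2) + 2 := by omega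
  unfold glueCentre
  simp only [mem_hexSide, Pi.add_apply, Matrix.cons_val_zero, Matrix.cons_val_one]
  push_cast at h0 h1 h2 hs1 hs2 ⊢
  generalize (Φ.period : ℤ) * s = t at hs1 hs2 ⊢
  refine ⟨by linarith, ?_, ?_⟩ <;> omega

/-- A lower bound `1 − δ` for a triple intersection of increasing events each of probability `> 1 − δ/3` (Harris twice; eq. (11)).
[cite: DuminilCopinSidoraviciusTassion2016, §2.1 eq. (11)] -/
theorem real_inter_three_ge [Countable V] (p : unitInterval) {A B C : Set (BondConfig V)} (hA : IsUpperSet A) (hB : IsUpperSet B) (hC : IsUpperSet C)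
    (hAm : MeasurableSet A) (hBm : MeasurableSet B) (hCm : MeasurableSet C) {δ : ℝ} (hδ : 0 < δ)
    (ha : 1 - δ / 3 < (bondPercolation G p).real A) (hb : 1 - δ / 3 < (bondPercolation G p).real B) (hc : 1 - δ / 3 < (bondPercolation G p).real C) :
    1 - δ ≤ (bondPercolation G p).real (A ∩ B ∩ C) := by
  set P := bondPercolation G p with hP
  have hH1 : P.real A * P.real B ≤ P.real (A ∩ B) := harris_fkg_holds G p hA hB hAm hBm
  have hH2 : P.real (A ∩ B) * P.real C ≤ P.real (A ∩ B ∩ C) := harris_fkg_holds G p (hA.inter hB) hC (hAm.inter hBm) hCm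
  rcases lt_or_ge 3 δ with hδ3 | hδ3
  · have : 0 ≤ P.real (A ∩ B ∩ C) := measureReal_nonneg
    linarith
  · have h0 : 0 ≤ 1 - δ / 3 := by linarith
    have h1 : (1 - δ / 3) * (1 - δ / 3) ≤ P.real A * P.real B := mul_le_mul ha.le hb.le h0 (h0.trans ha.le)
    have h2 : (1 - δ / 3) * (1 - δ / 3) * (1 - δ / 3) ≤ P.real (A ∩ B) * P.real C := mul_le_mul (h1.trans hH1) hc.le h0 measureReal_nonneg
    have hx1 : δ / 3 ≤ 1 := by linarith
    have hcube : 1 - δ ≤ (1 - δ / 3) * (1 - δ / 3) * (1 - δ / 3) := by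
      nlinarith [sq_nonneg (δ / 3), mul_nonneg (mul_nonneg (by positivity : (0:ℝ) ≤ δ / 3) (by positivity : (0:ℝ) ≤ δ / 3)) (sub_nonneg.2 hx1)]
    linarith [hH2, h2, hcube]

/-- **EQ. (12) FOR `p < 1` FROM THE GLUING LEMMA** (DST §2.1, eqs. (10)–(12), in hexagonal geometry; conclusion in the form of `Eq12Likely4` at `n = 2m`).
[cite: DuminilCopinSidoraviciusTassion2016, §2.1 eqs. (10)–(12)] -/
theorem eq12_of_hexGluing_lt_one [Countable V] (h6 : Φ.HexGluing) {v : V} {p : unitInterval} (hθ : 0 < theta G v p) (hp : (p : ℝ) < 1)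
    {u : ℕ → ℕ} (hu4 : ∀ n, 4 * u n ≤ n)
    (hlim : Tendsto (fun n => (bondPercolation G p).real (Φ.uniqueConn (hexBall Φ.centre n) (hexBall Φ.centre (u n)) (hexSphere Φ.centre n))) atTop (𝓝 1))
    (ε : ℝ) (hε : 0 < ε) (N : ℕ) :
    ∃ n : ℕ, N ≤ n ∧ Φ.period ∣ n ∧ ∃ s : ℤ, -(3 * (n : ℤ)) ≤ Φ.period * s ∧ (Φ.period : ℤ) * s ≤ n ∧
      1 - ε < (bondPercolation G p).real (Φ.conn (hexBall Φ.centre (4 * n)) (hexBall Φ.centre (u (3 * n)))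
        (hexBall (Φ.centre + (2 * (n : ℤ)) • Pi.single 0 1 + ((Φ.period : ℤ) * s) • Pi.single 1 1) (u n))) := by
  set c := Φ.centre with hc
  set P := bondPercolation G p with hP
  set Pd : ℕ := Φ.period with hPd
  have hPd1 : 1 ≤ Pd := Φ.period_pos
  -- inner radii at scale `m`: `v' m = u (2m) < 2m`
  set v' : ℕ → ℕ := fun m => u (2 * m) with hv'
  have hv : ∀ m, 1 ≤ m → v' m < 2 * m := fun m hm => by have := hu4 (2 * m); simp only [hv']; omega
  -- Lemma 4's input along even radii
  have hD : Tendsto (fun m => P.real (Φ.conn (hexBall c (2 * m)) (hexBall c (v' m)) (hexSphere c (2 * m)))) atTop (𝓝 1) := by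
    have h2 : Tendsto (fun m : ℕ => 2 * m) atTop atTop := tendsto_atTop_mono (fun m => show m ≤ 2 * m by omega) tendsto_id
    have hl := hlim.comp h2
    refine tendsto_of_tendsto_of_tendsto_of_le_of_le' hl tendsto_const_nhds (Filter.Eventually.of_forall fun m => ?_)
      (Filter.Eventually.of_forall fun m => measureReal_le_one)
    exact measureReal_mono (Φ.uniqueConn_subset_conn _ _ _)
  -- Lemma 4 and the slack
  obtain ⟨α, a, b, hαab, hevα, hT1, hT2⟩ := Φ.lemma4 p hp v' hv hD
  have hTk := Φ.tendsto_real_sideEvent_add p hp v' hv hT1 Pd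
  have hevk := Φ.eventually_lt_of_tendsto_sideEvent p hp v' hv hTk
  -- the node at `ε/2`
  obtain ⟨δ, hδ, m₀, hnode⟩ := h6 v p hθ hp (ε / 2) (by positivity)
  have hδ3 : 0 < δ / 3 := by positivity
  have hev1 : ∀ᶠ m in atTop, P.real (Φ.sideEvent c m (v' m) ((α m + Pd : ℕ) : ℤ) m) ∈ Set.Ioi (1 - δ / 3) :=
    hTk.eventually (Ioi_mem_nhds (show (1 : ℝ) - δ / 3 < 1 by linarith))
  have hev2 : ∀ᶠ m in atTop, P.real (Φ.sideEvent c m (v' m) (a m) (b m)) ∈ Set.Ioi (1 - δ / 3) :=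
    hT2.eventually (Ioi_mem_nhds (show (1 : ℝ) - δ / 3 < 1 by linarith))
  obtain ⟨M, hM⟩ := Filter.eventually_atTop.1 (hev1.and (hev2.and hevk))
  -- Lemma 5 along the multiples of the period
  obtain ⟨j, hj, hj1, hL5⟩ := lemma5_linear Pd (fun j => α (Pd * j)) (fun j hj => (hαab (Pd * j) (by nlinarith)).1)
    (fun j hj => (hαab (Pd * j) (by nlinarith)).2.1) (max (max m₀ M) (max N 1))
  set m : ℕ := Pd * j with hmdef
  have hjm : j ≤ m := by rw [hmdef]; nlinarith
  have hm₀ : m₀ ≤ m := ((le_max_left _ _).trans (le_max_left _ _)).trans (hj.trans hjm)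
  have hMm : M ≤ m := ((le_max_right _ _).trans (le_max_left _ _)).trans (hj.trans hjm)
  have hNm : N ≤ m := ((le_max_left _ _).trans (le_max_right _ _)).trans (hj.trans hjm)
  have hm1 : 1 ≤ m := ((le_max_right _ _).trans (le_max_right _ _)).trans (hj.trans hjm)
  have hPm : Pd ≤ m := by rw [hmdef]; nlinarith
  have hdvd : Pd ∣ m := ⟨j, rfl⟩
  have hL5' : α (3 * m) ≤ 4 * α m := by rw [hmdef, show 3 * (Pd * j) = Pd * (3 * j) by ring]; exact hL5
  obtain ⟨hM1, hM2, hMk⟩ := hM m hMm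
  obtain ⟨-, hM3, -⟩ := hM (3 * m) (by omega)
  obtain ⟨hα1, hαm, habm, hbαm, hlenm⟩ := hαab m hm1
  obtain ⟨hα13, hα3m, hab3, hbα3, hlen3⟩ := hαab (3 * m) (by omega)
  -- the data
  have hPpos : (0 : ℤ) < Pd := by exact_mod_cast hPd1
  have hsr : (((a (3 * m) + b (3 * m)) / 2 : ℕ) - 2 * (m : ℤ)) % Pd + Pd * ((((a (3 * m) + b (3 * m)) / 2 : ℕ) - 2 * (m : ℤ)) / Pd) =
      ((a (3 * m) + b (3 * m)) / 2 : ℕ) - 2 * (m : ℤ) := Int.emod_add_mul_ediv _ _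
  have hr0 : 0 ≤ (((a (3 * m) + b (3 * m)) / 2 : ℕ) - 2 * (m : ℤ)) % Pd := Int.emod_nonneg _ hPpos.ne'
  have hr1 : (((a (3 * m) + b (3 * m)) / 2 : ℕ) - 2 * (m : ℤ)) % Pd < Pd := Int.emod_lt_of_pos _ hPpos
  obtain ⟨s, hsdef⟩ : ∃ s : ℤ, s = (((a (3 * m) + b (3 * m)) / 2 : ℕ) - 2 * (m : ℤ)) / Pd := ⟨_, rfl⟩
  rw [← hsdef] at hsr
  have hs1 : (Pd : ℤ) * s ≤ ((a (3 * m) + b (3 * m)) / 2 : ℕ) - 2 * (m : ℤ) := by linarith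
  have hs2 : (((a (3 * m) + b (3 * m)) / 2 : ℕ) : ℤ) - 2 * (m : ℤ) < Pd * s + Pd := by linarith
  have hy3 : (a (3 * m) + b (3 * m)) / 2 ≤ 3 * m := by omega
  have hy3' : ((((a (3 * m) + b (3 * m)) / 2 : ℕ)) : ℤ) ≤ 3 * (m : ℤ) := by exact_mod_cast hy3
  have hy0 : (0 : ℤ) ≤ (((a (3 * m) + b (3 * m)) / 2 : ℕ) : ℤ) := by positivity
  have hPm' : (Pd : ℤ) ≤ m := by exact_mod_cast hPm
  have hsr1 : -(3 * (m : ℤ)) ≤ Pd * s := by linarith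
  have hsr2 : (Pd : ℤ) * s ≤ m := by linarith
  have hu₃r : 2 * v' (3 * m) ≤ 3 * m := by have := hu4 (2 * (3 * m)); simp only [hv']; omega
  have hu₁r : 2 * v' m ≤ m := by have := hu4 (2 * m); simp only [hv']; omega
  have haw1 : 1 ≤ α m + Pd := by omega
  have hawm : α m + Pd + 1 ≤ m := hMk
  have hR1 : -(3 * ((2 * m : ℕ) : ℤ)) ≤ Pd * s := by push_cast; linarith
  have hR2 : (Pd : ℤ) * s ≤ ((2 * m : ℕ) : ℤ) := by push_cast; linarith
  refine ⟨2 * m, by omega, Dvd.dvd.mul_left hdvd 2, s, hR1, hR2, ?_⟩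
  -- (10): `P[A] > 1 − δ/3`
  have hA : 1 - δ / 3 < P.real (Φ.glueA m (v' (3 * m)) (α m + Pd) s) := by
    refine lt_of_lt_of_le hM3 (measureReal_mono ?_)
    unfold glueA sideEvent
    rw [show 2 * (3 * m) = 6 * m by ring]
    exact Φ.conn_mono subset_rfl subset_rfl (Φ.hexSide_subset_landingZone hab3 (by omega) hs1 hs2)
  -- `P[B⁺] = P[B⁻] = P[E_m(α_m + period, m)] > 1 − δ/3`
  have hshift : Φ.glueCentre m s = c + (Φ.period : ℤ) • (![4 * (j : ℤ), s] : Site 2) := Φ.glueCentre_eq_shift rfl s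
  have hBp : 1 - δ / 3 < P.real (Φ.glueBp m (v' m) (α m + Pd) s) := by
    unfold glueBp
    rw [hshift, hP, Φ.real_sideEvent_shift]
    exact hM1
  have hBm : 1 - δ / 3 < P.real (Φ.glueBm m (v' m) (α m + Pd) s) := by
    unfold glueBm
    rw [hshift, hP, Φ.real_sideEvent_shift, Φ.real_sideEvent_flip]
    exact hM1
  -- (11): Harris twice
  have htriple : 1 - δ ≤ P.real (Φ.glueA m (v' (3 * m)) (α m + Pd) s ∩ Φ.glueBm m (v' m) (α m + Pd) s ∩ Φ.glueBp m (v' m) (α m + Pd) s) :=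
    real_inter_three_ge p (by unfold glueA; exact isUpperSet_openCrossing _ _ _) (by unfold glueBm; exact Φ.isUpperSet_sideEvent _ _ _ _ _)
      (by unfold glueBp; exact Φ.isUpperSet_sideEvent _ _ _ _ _) (by unfold glueA; exact Φ.measurableSet_conn_hexBall _ _ _ _)
      (by unfold glueBm; exact Φ.measurableSet_sideEvent _ _ _ _ _) (by unfold glueBp; exact Φ.measurableSet_sideEvent _ _ _ _ _) hδ hA hBm hBp
  -- the Gluing Lemma
  have hC : 1 - ε / 2 ≤ P.real (Φ.glueC m (v' (3 * m)) (v' m) s) := hnode m (v' (3 * m)) (v' m) (α m + Pd) s hm₀ hdvd hu₃r hu₁r haw1 hawm hsr1 hsr2 htriple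
  -- (12): `H₃ ∪ B' ⊆ hexBall c 8m`
  have hmono : Φ.glueC m (v' (3 * m)) (v' m) s ⊆ Φ.conn (hexBall c (4 * (2 * m))) (hexBall c (u (3 * (2 * m))))
      (hexBall (c + (2 * ((2 * m : ℕ) : ℤ)) • Pi.single 0 1 + ((Pd : ℤ) * s) • Pi.single 1 1) (u (2 * m))) := by
    unfold glueC
    refine Φ.conn_mono (Φ.glueRegion_subset m hsr1 hsr2) (subset_of_eq ?_) (subset_of_eq ?_)
    · show hexBall c (u (2 * (3 * m))) = hexBall c (u (3 * (2 * m)))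
      rw [Nat.mul_left_comm]
    · rw [← Φ.glueCentre_eq_single m s]
  have hfin := measureReal_mono (μ := P) hmono
  linarith

end HexShadow

end Summit.CriticalPhenomena.PercolationContinuityZ3.Theorems.Transplant

end
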